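import Literature.NumberTheory.Transcendental.PkappaTheta
import HarnessLib

/-!
# The theta model of `M_κ`: growth of order two

Topic: `Literature/NumberTheory/Transcendental`. Sequel to `PkappaTheta.lean`, part of the theta
model (plan item W2 of the unit `provefact-Literature.NumberTheory.Transcendental.H-b596640137`).
PROVED here (`GaGmE.Std.exists_norm_theta_le`): the theta functions of `M_κ = 𝔾ₘ^β × P_κ` have
order-two growth on `Lie M_κ,ℂ`,

`‖Θ_J(w)‖ ≤ e^{C (1 + ‖w‖²)}`  for all `J` and `w`, with one constant `C`,

from the blockwise bound `‖P_i(z)‖, ‖Z_i(z)‖ ≤ e^{C₀(1 + |z|²)}` (`UnivExtTheta.lean`),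
`|e^{y}| ≤ e^{|y|}`, `|w_i| ≤ ‖w‖` (sup norm) and the elementary absorptions `‖w‖ ≤ 1 + ‖w‖²`,
`1 + x ≤ eˣ`. This is the input `log |f_i(z)| ≤ c₁ + c₂‖z‖²` of Baker's method
(Baker–Wüstholz 2007, §6.8, p. 116) for the group `M_κ`.

## References

* A. Baker, G. Wüstholz, *Logarithmic Forms and Diophantine Geometry*, CUP 2007, §6.8 (p. 116).
-/

noncomputable section

open Complex
open scoped PeriodPair

namespace Literature.NumberTheory.Transcendental

namespace GaGmE

namespace Std

variable {β γ δ : Type} [Fintype β] [Fintype γ] [Fintype δ] [DecidableEq γ]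
variable (L : PeriodPair) (κM : δ → γ → Kbar)

omit [Fintype β] [Fintype γ] [Fintype δ] [DecidableEq γ] in
/-- A finite product of quantities in `[0, E]`-norm is bounded by `E^{card}`; with `1 ≤ E` also by
`E^n` for any `n ≥ card`. [folklore] -/
theorem norm_prod_le_pow {ι : Type*} (u : Finset ι) {f : ι → ℂ} {E : ℝ} (hE : 1 ≤ E)
    (hf : ∀ i ∈ u, ‖f i‖ ≤ E) {n : ℕ} (hn : u.card ≤ n) : ‖∏ i ∈ u, f i‖ ≤ E ^ n := by
  calc ‖∏ i ∈ u, f i‖ ≤ ∏ i ∈ u, ‖f i‖ := Finset.norm_prod_le _ _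
    _ ≤ ∏ _i ∈ u, E := Finset.prod_le_prod (fun i _ => norm_nonneg _) hf
    _ = E ^ u.card := Finset.prod_const E
    _ ≤ E ^ n := pow_le_pow_right₀ hE hn

/-- **Order-two growth of the theta functions of `M_κ`.** There is `C ≥ 0` with
`‖Θ_J(w)‖ ≤ e^{C(1 + ‖w‖²)}` for all `J` and `w ∈ Lie M_κ,ℂ` (sup norm).
[cite: BakerWustholz2007, §6.8 (p. 116: log |f_i(z)| ≤ c₁ + c₂‖z‖²)] -/
theorem exists_norm_theta_le :
    ∃ C : ℝ, 0 ≤ C ∧ ∀ (J : Option β × ThetaIdx γ δ) (w : β ⊕ (γ ⊕ δ) → ℂ),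
      ‖theta L κM J w‖ ≤ Real.exp (C * (1 + ‖w‖ ^ 2)) := by
  obtain ⟨C₀, hC₀, hPZ⟩ := L.exists_norm_univExtP_univExtZ_le
  -- the size of the push-out matrix
  set K : ℝ := ∑ e, ∑ b, ‖(κM e b : ℂ)‖ with hK
  have hK0 : 0 ≤ K := Finset.sum_nonneg fun e _ => Finset.sum_nonneg fun b _ => norm_nonneg _
  set n : ℕ := Fintype.card γ with hn
  refine ⟨C₀ * (n + 1) + K + 3, by positivity, fun J w => ?_⟩
  set R : ℝ := ‖w‖ with hR
  have hR0 : 0 ≤ R := norm_nonneg _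
  have hcoord : ∀ i, ‖w i‖ ≤ R := fun i => norm_le_pi_norm w i
  -- the blockwise bound at the coordinates of `w`
  set E : ℝ := Real.exp (C₀ * (1 + R ^ 2)) with hE
  have hE1 : 1 ≤ E := Real.one_le_exp (by positivity)
  have hE0 : 0 ≤ E := zero_le_one.trans hE1
  have hmonoC : ∀ b, Real.exp (C₀ * (1 + ‖w (iz b)‖ ^ 2)) ≤ E := fun b =>
    Real.exp_le_exp.mpr (by
      have := hcoord (iz b)
      have h2 : ‖w (iz b)‖ ^ 2 ≤ R ^ 2 := pow_le_pow_left₀ (norm_nonneg _) this 2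
      nlinarith)
  have hP : ∀ i b, ‖L.univExtP i (w (iz b))‖ ≤ E := fun i b => ((hPZ i _).1).trans (hmonoC b)
  have hZ : ∀ i b, ‖L.univExtZ i (w (iz b))‖ ≤ E := fun i b => ((hPZ i _).2).trans (hmonoC b)
  -- products of blocks
  have hnone : ∀ M : γ → Fin 3, ‖thetaPnone (β := β) (δ := δ) L M w‖ ≤ E ^ n := fun M =>
    norm_prod_le_pow Finset.univ hE1 (fun b _ => hP (M b) b) (by simp [hn])
  have herase : ∀ (M : γ → Fin 3) (b : γ),
      ‖∏ b' ∈ Finset.univ.erase b, L.univExtP (M b') (w (iz b'))‖ ≤ E ^ n := fun M b =>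
    norm_prod_le_pow _ hE1 (fun b' _ => hP (M b') b')
      ((Finset.card_erase_le).trans (by simp [hn]))
  have hEn0 : 0 ≤ E ^ n := pow_nonneg hE0 n
  have hsome : ∀ (M : γ → Fin 3) (e : δ), ‖thetaPsome (β := β) L κM M e w‖ ≤ (R + K) * E ^ (n + 1) := by
    intro M e
    have hEn1 : E ^ n ≤ E ^ (n + 1) := pow_le_pow_right₀ hE1 (Nat.le_succ n)
    have hEn10 : 0 ≤ E ^ (n + 1) := pow_nonneg hE0 _
    have h1 : ‖w (is e) * thetaPnone (β := β) (δ := δ) L M w‖ ≤ R * E ^ (n + 1) := by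
      rw [norm_mul]
      exact mul_le_mul (hcoord _) ((hnone M).trans hEn1) (norm_nonneg _) hR0
    have h2 : ‖∑ b, (κM e b : ℂ) * (L.univExtZ (M b) (w (iz b)) *
        ∏ b' ∈ Finset.univ.erase b, L.univExtP (M b') (w (iz b')))‖ ≤ K * E ^ (n + 1) := by
      calc _ ≤ ∑ b, ‖(κM e b : ℂ) * (L.univExtZ (M b) (w (iz b)) *
              ∏ b' ∈ Finset.univ.erase b, L.univExtP (M b') (w (iz b')))‖ := norm_sum_le _ _
        _ ≤ ∑ b, ‖(κM e b : ℂ)‖ * E ^ (n + 1) := by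
            refine Finset.sum_le_sum fun b _ => ?_
            rw [norm_mul, norm_mul, pow_succ']
            refine mul_le_mul_of_nonneg_left ?_ (norm_nonneg _)
            exact mul_le_mul (hZ (M b) b) (herase M b) (norm_nonneg _) hE0
        _ = (∑ b, ‖(κM e b : ℂ)‖) * E ^ (n + 1) := (Finset.sum_mul _ _ _).symm
        _ ≤ K * E ^ (n + 1) := by
            refine mul_le_mul_of_nonneg_right ?_ hEn10
            rw [hK]
            exact Finset.single_le_sum (f := fun e => ∑ b, ‖(κM e b : ℂ)‖)
              (fun e _ => Finset.sum_nonneg fun b _ => norm_nonneg _) (Finset.mem_univ e)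
    calc ‖thetaPsome (β := β) L κM M e w‖ ≤ ‖w (is e) * thetaPnone (β := β) (δ := δ) L M w‖ +
          ‖∑ b, (κM e b : ℂ) * (L.univExtZ (M b) (w (iz b)) *
            ∏ b' ∈ Finset.univ.erase b, L.univExtP (M b') (w (iz b')))‖ := norm_sub_le _ _
      _ ≤ R * E ^ (n + 1) + K * E ^ (n + 1) := add_le_add h1 h2
      _ = (R + K) * E ^ (n + 1) := by ring
  -- all theta functions of `P_κ` at once
  have hthetaP : ∀ I, ‖thetaP (β := β) L κM I w‖ ≤ (1 + R + K) * E ^ (n + 1) := by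
    rintro ⟨M, _ | e⟩
    · rw [thetaP_none]
      calc ‖thetaPnone L M w‖ ≤ E ^ n := hnone M
        _ ≤ E ^ (n + 1) := pow_le_pow_right₀ hE1 (Nat.le_succ n)
        _ = 1 * E ^ (n + 1) := (one_mul _).symm
        _ ≤ (1 + R + K) * E ^ (n + 1) := by gcongr; linarith
    · rw [thetaP_some]
      calc ‖thetaPsome L κM M e w‖ ≤ (R + K) * E ^ (n + 1) := hsome M e
        _ ≤ (1 + R + K) * E ^ (n + 1) := by gcongr; linarith
  -- the torus coordinates
  have hT : ∀ a, ‖thetaT (γ := γ) (δ := δ) a w‖ ≤ Real.exp R := by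
    rintro (_ | j)
    · simpa using Real.one_le_exp hR0
    · rw [thetaT_some, Complex.norm_exp]
      exact Real.exp_le_exp.mpr ((Complex.re_le_norm _).trans (hcoord _))
  -- assemble
  have hmain : ‖theta L κM J w‖ ≤ Real.exp R * ((1 + R + K) * E ^ (n + 1)) := by
    rw [theta, norm_mul]
    exact mul_le_mul (hT J.1) (hthetaP J.2) (norm_nonneg _) (Real.exp_pos R).le
  refine hmain.trans ?_
  -- `e^R (1 + R + K) E^{n+1} ≤ e^{(C₀(n+1) + K + 3)(1 + R²)}`
  have hlin : 1 + R + K ≤ Real.exp (R + K) := by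
    have := Real.add_one_le_exp (R + K); linarith
  have hEn : E ^ (n + 1) = Real.exp (C₀ * (n + 1) * (1 + R ^ 2)) := by
    rw [hE, ← Real.exp_nat_mul]; congr 1; push_cast; ring
  have hR2 : R ≤ 1 + R ^ 2 := by nlinarith [sq_nonneg (R - 1)]
  calc Real.exp R * ((1 + R + K) * E ^ (n + 1))
      ≤ Real.exp R * (Real.exp (R + K) * E ^ (n + 1)) := by
        gcongr
    _ = Real.exp (R + (R + K) + C₀ * (n + 1) * (1 + R ^ 2)) := by
        rw [hEn, ← Real.exp_add, ← Real.exp_add]; ring_nf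
    _ ≤ Real.exp ((C₀ * (n + 1) + K + 3) * (1 + ‖w‖ ^ 2)) := by
        rw [← hR]
        refine Real.exp_le_exp.mpr ?_
        nlinarith [mul_nonneg hK0 (sq_nonneg R), sq_nonneg R]

end Std

end GaGmE

end Literature.NumberTheory.Transcendental

end
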